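import Literature.MathematicalPhysics.QuantumFieldTheory.Balaban1983to89.B8Thm2TorusLettersPerOfKnit
import Literature.MathematicalPhysics.QuantumFieldTheory.Balaban1983to89.B9B8KnitLetterRegular
import Literature.MathematicalPhysics.QuantumFieldTheory.Balaban1983to89.B8Ineq1144TwistedAxial
import Literature.MathematicalPhysics.QuantumFieldTheory.Balaban1983to89.B8Thm2TorusAtOfLettersPerB9

/-!
# `Balaban1983to89.B8Thm2TorusLettersAllPerOfKnit` — M5.9 ASSEMBLY, FILE A3: the BINDER `B8Thm2TorusLettersPer.LettersAllPer` of [Balaban1985RegularSpaces]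
# Thm 2 on `T_η` (every truncation `m ≤ k`, every regularity `α₀ ≤ c_L`, every `G`-valued periodic background of the class (1.7)) from the
# [Balaban1985BackgroundPropagators] objects at print's transporters — the `G`-valuedness of the knit legs DISCHARGED from the class `𝔄_k(T_η, α₀)` itself

statement-level skeleton of published theorems with citation tags; proofs where landed; nothing here is a claim about the
Yang–Mills mass gap

T. Bałaban, *Spaces of regular gauge field configurations on a lattice and gauge fixing conditions*, Commun. Math. Phys. **99** (1985) 75–102
[`Balaban1985RegularSpaces`, "[B8]"]: (1.7) p. 77 (*«|U(∂p) − 1| < α₀L^{−2j}» for `p ∈ Ω_j`, `j = 0, …, k`* — the class `𝔄_k({Ω_j}, α₀)`), p. 77 (*«we admit the case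
where some domains Ω_j are equal to T_η»*), Thm 2 p. 83, Thm 4 p. 88, (1.28)–(1.29) p. 81 (the averaged configurations `Ū^j` and their contours),
(1.91)–(1.98) pp. 91–92.  T. Bałaban, *Averaging operations for lattice gauge theories*, Commun. Math. Phys. **98** (1985) 17–51 [`Balaban1985Averaging`, "[B7]"]:
Prop. 2 p. 26 ((52): *«|U(∂p) − 1| < α₀L^{−2k}η²»* ⇒ (53)–(54): all averages `Ū^j`, `j ≤ k`, stay in the group and are small).  T. Bałaban, *Propagators for
lattice gauge theories in a background field*, Commun. Math. Phys. **99** (1985) 389–434 [`Balaban1985BackgroundPropagators`, "[4]"]: (3.19) p. 393 (*«U(Γ^{(j)}_{y,x})»*,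
the composite contours of the averaged fields), Thms 3.1–3.3 pp. 397–399.  STATUS: published, refereed.

CITATION HEADER (lean-in-tree rule).  Cell `lit-balaban`, seat `lit-balaban-t2s-1` (gen 4), MODULE M5.9 of the G-B9-LETTERS map of record, file A3; sub-row
G-B8-T2S (R3 `stmt-QuantumFields-19200`, helper).  WHY THIS FILE.  File A2 (`B8Thm2TorusLettersPerOfKnit.lettersAtPer_ofParKnitY`) constructs the v3 letter bundle
`LettersAtPer` at ONE background from [4]'s objects under the hypothesis `hpar` — the knit legs `U(Γ^{(j)}_{y,x})` (composite contours of the AVERAGED fields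
`Ū^j`, `j < n`, [4] (3.19), [B8] (1.29)) are `G`-valued.  The consumer's binder `LettersAllPer … c_L η k P G` quantifies over every truncation `m ≤ k`, every
`0 < α₀ ≤ c_L` and every `G`-valued `P`-periodic `U₀ ∈ 𝔄_m(T_η, α₀)` ([B8] (1.7) on the whole torus at the levels `j ≤ m`: `|U₀(∂p) − 1| < α₀L^{−2j}`).  THIS
FILE discharges `hpar` from membership in that class: (1.7) at the top level gives [B7] (52) `|U₀(∂p) − 1| ≤ α₀L^{−2n} < α₀L^{−2(n−1)}`, so by [B7] Prop. 2
(`B7Prop2Explicit.avgIter_mem`, for an averaging-closed `G` and `α₀ ≤ c_L` below Prop. 2's thresholds) every average `Ū₀^j`, `j ≤ n − 1`, is `G`-valued —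
and a member of CONSTANT level `n` reads ONLY the averages of levels `j < n` in its legs (`knitT_mem_of_lev`, sharpening `B9B8KnitLetterRegular.parOfT_mem`,
which asks the levels `< k` of the family index).  Then it assembles the BINDER.

WHAT THIS FILE PROVES (sorry-free; the only definitions are DATA — the letter families and the binders; no estimate of [B8]∕[4] asserted).
* §1 ★ `pdev_le_of_inAk_univ` ((1.7) on `T_η` at level `n` ⇒ `pdev U₀ ≤ α₀L^{−2n}`), `pdev_lt_of_inAk_univ` (`< α₀L^{−2(n−1)}`, `L ≥ 2`, `n ≥ 1`),
  `inAk_univ_of_le`, ★ `avgIter_mem_of_inAk` (all averages `Ū₀^j`, `j ≤ n − 1`, `G`-valued), `knitT_mem_of_lev` ∕ `parOfT_mem_of_lev` (the knit letter at a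
  constant-level-`n` member is `G`-valued from `G`-valued legs of levels `< n`), ★★ `parKnitY_mem_of_inAk` — `hpar` of file A2 from `U₀ ∈ 𝔄_n(T_η, α₀)`,
  `G` averaging-closed, `C₀α₀ ≤ 1∕3`, `2α₀ ≤ c₂′`.
* §2 at `M_N(ℂ)` (`N ≥ 1`): `knitLettersY_familyOfInAk` (A2's def-Y-side family with `hpar` discharged; `_G'` ∕ `_C'` ∕ `_H'`: its letters ARE the junction's,
  `rfl`), ★★ `lettersAtPer_ofInAk` (A2's bundle at one background of the class, hypotheses = the binder's own + `KnitEstimates`), `knitLettersY_familyAt` (the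
  family at truncation `m ≤ k`, thresholds read off `α₀ ≤ c_L`), ★★★ **`lettersAllPer_ofParKnitY : LettersAllPer (ℓ+1) BG BR B₀'H B₂' B₀ B₀β cB β len cL η k P G`**
  — THE DISPLAYED HYPOTHESIS OF THE G-B8-T2S ENDPOINT `B8Thm2TorusAtOfLettersPerB9.thm2TorusAt_specialUnitary_of_lettersPerB9`, CONSTRUCTED from [4]'s objects
  at print's transporters for every background of the class, MODULO: the estimate bundle `KnitEstimates` at each background (the six printed inequalities (1.92),
  (1.101), (1.98), (1.59) for these objects — sub-row G-B9-LETTERS), a family of constant-level members of the k-level family on the torus of side `P` (one per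
  truncation), `G ≤ U(N)` averaging-closed, and `c_L` below [B7] Prop. 2's thresholds; ★ `lettersAllPerTau_ofParKnitY` — the `τ`-laws binder from the def-Y-side
  `τ`-laws (`KnitLettersYTau`, displayed).
* §3 at `G = SU(N)`, `N ≤ 25` (`SU(N) ≤ U(N)`, `B7AvgClosedSpecialUnitarySharp.avgClosed_specialUnitary_of_le`): ★★★ `lettersAllPer_specialUnitary_ofParKnitY` (no
  group hypothesis left), ★★★★ **`thm2TorusAt_specialUnitary_ofParKnitY`** — the endpoint COMPOSED with the binders: uniform `B₂, c₁ > 0` with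
  `Thm2TorusAt (ℓ+1) k P η 0 B₁ B₂ c₁ len SU(N) ⊤` for every `k ≥ 1`, `η > 0`, `P ∈ LᵏZ`, GIVEN a member family for `(k, P)`, the estimate bundles and the trace
  laws per background — [B8] Thm 2 on `T_η` with its Landau-gauge letters BEING [4]'s operators, modulo exactly the printed estimates for them.

HONEST SCOPE.  The member constraints of def-Y's carrier (`L = ℓ+1 ≥ 5` odd, family index `≥ 2`, `N₀ = Lᵏ·L·M_h·P′`, constant level) are displayed as the
hypothesis `mem ∕ hP ∕ hlev`, not discharged; no estimate of [B8]∕[4] is proved: `KnitEstimates` and `KnitLettersYTau` stay displayed; count-neutral; N05 ∕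
`stub_PV3A` NOT discharged; nothing continuum ∕ ℝ⁴ ∕ OS ∕ mass-gap ∕ Clay — the Yang–Mills mass gap is NOT proved.  No `sorry`, no `axiom`, no `… : Prop` fact,
no `instance`, no `notation`.  NEW file; nothing landed is modified.  Seat `lit-balaban-t2s-1` gen 4, 2026-08-28.
-/

noncomputable section

open scoped BigOperators

namespace Literature.MathematicalPhysics.QuantumFieldTheory.Balaban1983to89.B8Thm2TorusLettersAllPerOfKnit

open B7Prop1Explicit renaming Site → LSite
open B7Prop1Explicit (e)
open B7Prop2Explicit (unitaryUnits pdev AvgClosed avgIter_mem hol_mem_of C0 c2' C0_pos)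
open B8Ineq132 (InAk plaqF)
open B8Ineq1144TwistedAxial (pdev_le_of_forall)
open B8Eq119TwistedAxial (bgT)
open B8Thm2TorusLettersPer (LettersAtPer LettersPerTau LettersAllPer LettersAllPerTau)
open B12Ineq417Flat (shiftCfg shiftCfg_apply)
open B6GlobalChartV1 (PV)
open B6KLevelCensusIndexV1 (KIdx)
open B9B8CarrierDictionary (liftCfg)
open B9B8AveragingJunction (knitT parOfT parKnitY)
open B9B8KnitLetterRegular (compT_mem)
open B9Thm311PositivityKnitLetter (GpKnitY)
open B8Thm2TorusLettersPerOfKnit (bgY liftCfg_bgY KnitLettersY KnitLettersYTau KnitEstimates lettersAtPer_ofKnit lettersPerTau_ofKnit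
  knitLettersY_ofParKnitY)
open Node00

variable {d ℓ : ℕ} {hd : 1 ≤ d + 1} {hL : Odd (ℓ + 1) ∧ 1 < ℓ + 1} {b₀ b₁ : ℝ}

/-! ## §1 The knit legs are `G`-valued on the class (1.7) of the torus -/

section Legs

variable {𝔸 : Type} [NormedRing 𝔸] [NormOneClass 𝔸] [NormedAlgebra ℂ 𝔸] [CompleteSpace 𝔸]

omit [NormOneClass 𝔸] [CompleteSpace 𝔸] in
/-- ★ **(1.7) ON THE WHOLE TORUS AT LEVEL `n` BOUNDS [B7]'s PLAQUETTE DEVIATION**: `U₀ ∈ 𝔄_n(T_η, α₀)` (`Ω_j = T_η`, `j ≤ n`) ⇒ `sup_p |U₀(∂p) − 1| ≤ α₀L^{−2n}`.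
[cite: Balaban1985RegularSpaces, (1.7) p.77, p.77 («Ω_j = T_η»); Balaban1985Averaging, (52) p.26] -/
theorem pdev_le_of_inAk_univ {L n : ℕ} {η α₀ : ℝ} (hα : 0 ≤ α₀) {U₀ : LSite (d + 1) → Fin (d + 1) → 𝔸ˣ}
    (hA : InAk L n η α₀ (fun _ => (Set.univ : Set (LSite (d + 1)))) U₀) : pdev U₀ ≤ α₀ * (((L : ℝ) ^ n)⁻¹) ^ 2 :=
  pdev_le_of_forall (by positivity) fun x κ ν hκν => ((hA n le_rfl).1 x κ ν hκν (Or.inl (Set.mem_univ _))).le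

omit [NormOneClass 𝔸] [CompleteSpace 𝔸] in
/-- ★ hence [B7] (52) AT THE LEVEL BELOW, STRICTLY: `sup_p |U₀(∂p) − 1| < α₀L^{−2(n−1)}` (`L ≥ 2`, `n ≥ 1`, `α₀ > 0`).
[cite: Balaban1985RegularSpaces, (1.7) p.77; Balaban1985Averaging, (52) p.26] -/
theorem pdev_lt_of_inAk_univ {L n : ℕ} (hL2 : 2 ≤ L) (hn : 1 ≤ n) {η α₀ : ℝ} (hα : 0 < α₀) {U₀ : LSite (d + 1) → Fin (d + 1) → 𝔸ˣ}
    (hA : InAk L n η α₀ (fun _ => (Set.univ : Set (LSite (d + 1)))) U₀) : pdev U₀ < α₀ * (((L : ℝ) ^ (n - 1))⁻¹) ^ 2 := by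
  have hLr : (1 : ℝ) < (L : ℝ) := by exact_mod_cast hL2
  have hlt : (L : ℝ) ^ (n - 1) < (L : ℝ) ^ n := pow_lt_pow_right₀ hLr (Nat.sub_lt hn one_pos)
  have hinv : ((L : ℝ) ^ n)⁻¹ < ((L : ℝ) ^ (n - 1))⁻¹ := (inv_lt_inv₀ (by positivity) (by positivity)).2 hlt
  have hsq : (((L : ℝ) ^ n)⁻¹) ^ 2 < (((L : ℝ) ^ (n - 1))⁻¹) ^ 2 := pow_lt_pow_left₀ hinv (by positivity) two_ne_zero
  exact (pdev_le_of_inAk_univ hα.le hA).trans_lt (mul_lt_mul_of_pos_left hsq hα)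

omit [NormOneClass 𝔸] [CompleteSpace 𝔸] in
/-- restriction of (1.7) on `T_η` from the levels `≤ m` to the levels `≤ n`, `n ≤ m`. [cite: Balaban1985RegularSpaces, (1.7) p.77, bookkeeping] -/
theorem inAk_univ_of_le {L m n : ℕ} (hnm : n ≤ m) {η α₀ : ℝ} {U₀ : LSite (d + 1) → Fin (d + 1) → 𝔸ˣ}
    (hA : InAk L m η α₀ (fun _ => (Set.univ : Set (LSite (d + 1)))) U₀) : InAk L n η α₀ (fun _ => (Set.univ : Set (LSite (d + 1)))) U₀ :=
  fun j hj => hA j (hj.trans hnm)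

/-- ★ **[B7] PROP. 2 ON THE CLASS (1.7) OF THE TORUS**: for an averaging-closed `G`, a `G`-valued `U₀ ∈ 𝔄_n(T_η, α₀)` with `C₀α₀ ≤ 1∕3`, `2α₀ ≤ c₂′`, every average
`Ū₀^j`, `j ≤ n − 1`, is `G`-valued. [cite: Balaban1985Averaging, Prop. 2 p.26, (52)–(54) pp.26–27; Balaban1985RegularSpaces, (1.7) p.77, (1.28) p.81] -/
theorem avgIter_mem_of_inAk {L n : ℕ} (hL2 : 2 ≤ L) (hn : 1 ≤ n) {G : Subgroup 𝔸ˣ} (hGa : AvgClosed (d + 1) L G)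
    {U₀ : LSite (d + 1) → Fin (d + 1) → 𝔸ˣ} (hU₀G : ∀ x κ, U₀ x κ ∈ G) {η α₀ : ℝ} (hα : 0 < α₀) (hα3 : C0 (d + 1) * α₀ ≤ 1 / 3) (hα2 : 2 * α₀ ≤ c2' (d + 1) L)
    (hA : InAk L n η α₀ (fun _ => (Set.univ : Set (LSite (d + 1)))) U₀) :
    ∀ j ≤ n - 1, ∀ x κ, B7Prop2Explicit.avgIter L U₀ j x κ ∈ G :=
  avgIter_mem L hL2 hGa (n - 1) U₀ hU₀G hα hα3 hα2 (pdev_lt_of_inAk_univ hL2 hn hα hA)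

variable (i : KIdx d ℓ hd hL b₀ b₁) {G : Subgroup 𝔸ˣ}

omit [NormOneClass 𝔸] [NormedAlgebra ℂ 𝔸] [CompleteSpace 𝔸] in
/-- at a member of CONSTANT level `n` the knit transporter to a site reads the legs of levels `< n` only: `G`-valued legs below `n` ⇒ `G`-valued transporter.
[cite: Balaban1985BackgroundPropagators, (3.19) p.393 («U(Γ^{(j)}_{y,x})»), bookkeeping] -/
theorem knitT_mem_of_lev {n : ℕ} (hlev : ∀ z : SiteY i, levY i z = n) {T : ℕ → LSite (d + 1) → LSite (d + 1) → 𝔸ˣ}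
    (hT : ∀ j < n, ∀ y x, T j y x ∈ G) (w : SiteY i) : knitT i T w ∈ G :=
  compT_mem (ℓ + 1) (levY i w) (fun j' hj' => hT j' (lt_of_lt_of_eq hj' (hlev w))) _ _

omit [NormOneClass 𝔸] [NormedAlgebra ℂ 𝔸] [CompleteSpace 𝔸] in
/-- every value of the letter `parOfT T` at a constant-level-`n` member is `G`-valued when the legs of levels `< n` are.
[cite: Balaban1985BackgroundPropagators, (3.19) p.393, (3.24) p.394, bookkeeping] -/
theorem parOfT_mem_of_lev {n : ℕ} (hlev : ∀ z : SiteY i, levY i z = n) {T : ℕ → LSite (d + 1) → LSite (d + 1) → 𝔸ˣ}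
    (hT : ∀ j < n, ∀ y x, T j y x ∈ G) (z w : SiteY i) : parOfT i T z w ∈ G := by
  unfold parOfT
  split_ifs
  · exact knitT_mem_of_lev i hlev hT w
  · exact G.inv_mem (knitT_mem_of_lev i hlev hT z)
  · exact G.one_mem

/-- ★★ **THE KNIT LETTER IS `G`-VALUED ON THE CLASS (1.7) OF THE TORUS** (`hpar` of file A2, discharged): at a member of constant level `n ≥ 1`, for an
averaging-closed `G`, a `G`-valued `N₀`-periodic `U₀ ∈ 𝔄_n(T_η, α₀)` with `C₀α₀ ≤ 1∕3`, `2α₀ ≤ c₂′`: every `U(Γ_{z,w})` of `parKnitY` at the background `U₀` read on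
def-Y's torus is in `G` — the legs are contours of `Ū₀^j`, `j < n`, `G`-valued by [B7] Prop. 2.
[cite: Balaban1985Averaging, Prop. 2 p.26, (52)–(54) pp.26–27; Balaban1985RegularSpaces, (1.7) p.77, (1.28)–(1.29) p.81; Balaban1985BackgroundPropagators, (3.19) p.393] -/
theorem parKnitY_mem_of_inAk {n : ℕ} (hlev : ∀ z : SiteY i, levY i z = n) (hn : 1 ≤ n) (hGa : AvgClosed (d + 1) (ℓ + 1) G)
    {U₀ : LSite (d + 1) → Fin (d + 1) → 𝔸ˣ} (hU₀G : ∀ x κ, U₀ x κ ∈ G)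
    (hU₀per : ∀ μ : Fin (d + 1), shiftCfg ((((PV d ℓ i.m i.K hd hL).sitesPerDir 0 : ℕ) : ℤ) • e μ) U₀ = U₀)
    {η α₀ : ℝ} (hα : 0 < α₀) (hα3 : C0 (d + 1) * α₀ ≤ 1 / 3) (hα2 : 2 * α₀ ≤ c2' (d + 1) (ℓ + 1))
    (hA : InAk (ℓ + 1) n η α₀ (fun _ => (Set.univ : Set (LSite (d + 1)))) U₀) :
    ∀ z w : SiteY i, parKnitY i (bgY i U₀) z w ∈ G := by
  have hL2 : 2 ≤ ℓ + 1 := hL.2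
  have havg := avgIter_mem_of_inAk hL2 hn hGa hU₀G hα hα3 hα2 hA
  intro z w
  show parOfT i (bgT (ℓ + 1) (liftCfg (bgY i U₀))) z w ∈ G
  rw [liftCfg_bgY i hU₀per]
  exact parOfT_mem_of_lev i hlev (fun j hj y x => hol_mem_of (havg j (by omega)) _ _) z w

end Legs

/-! ## §2 At `M_N(ℂ)`: the bundle at every background of the class — the binder `LettersAllPer` -/

section Binder

open scoped Matrix Matrix.Norms.L2Operator

variable {N : ℕ} [NeZero N] {G : Subgroup (Matrix (Fin N) (Fin N) ℂ)ˣ}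

/-- Prop. 2's first threshold at `α₀ ≤ c_L`: `C₀α₀ ≤ C₀c_L ≤ 1∕3`. [cite: Balaban1985Averaging, Prop. 2 p.26, bookkeeping] -/
theorem threshold3_of_le {D : ℕ} {α₀ cL : ℝ} (hc : α₀ ≤ cL) (hc3 : C0 D * cL ≤ 1 / 3) : C0 D * α₀ ≤ 1 / 3 :=
  (mul_le_mul_of_nonneg_left hc (C0_pos D).le).trans hc3

/-- Prop. 2's second threshold at `α₀ ≤ c_L`: `2α₀ ≤ 2c_L ≤ c₂′`. [cite: Balaban1985Averaging, Prop. 2 p.26, bookkeeping] -/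
theorem threshold2_of_le {D L : ℕ} {α₀ cL : ℝ} (hc : α₀ ≤ cL) (hc2 : 2 * cL ≤ c2' D L) : 2 * α₀ ≤ c2' D L :=
  (mul_le_mul_of_nonneg_left hc zero_le_two).trans hc2

/-- **THE FAMILY OF def-Y-SIDE BUNDLES ON THE CLASS (1.7)** (file A2's `knitLettersY_family` with `hpar` DISCHARGED by `parKnitY_mem_of_inAk`): members `mem n` of
constant level `n` on the torus of side `P` (`1 ≤ n ≤ m`), `G ≤ U(N)` averaging-closed, a `G`-valued `P`-periodic `U₀ ∈ 𝔄_m(T_η, α₀)` with `C₀α₀ ≤ 1∕3`, `2α₀ ≤ c₂′`, `η ≠ 0`.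
[cite: Balaban1985BackgroundPropagators, (3.24)–(3.25) pp.394–395, Thm 3.11 p.416; Balaban1985RegularSpaces, (1.7) p.77, (1.91)–(1.98) pp.91–92; Balaban1985Averaging, Prop. 2 p.26] -/
def knitLettersY_familyOfInAk (mem : ℕ → KIdx d ℓ hd hL b₀ b₁) {m : ℕ} {P : ℤ}
    (hP : ∀ n, 1 ≤ n → n ≤ m → (((PV d ℓ (mem n).m (mem n).K hd hL).sitesPerDir 0 : ℕ) : ℤ) = P)
    (hlev : ∀ n, 1 ≤ n → n ≤ m → ∀ z : SiteY (mem n), levY (mem n) z = n)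
    (hG : G ≤ unitaryUnits (Matrix (Fin N) (Fin N) ℂ)) (hGa : AvgClosed (d + 1) (ℓ + 1) G)
    {U₀ : LSite (d + 1) → Fin (d + 1) → (Matrix (Fin N) (Fin N) ℂ)ˣ} (hU₀G : ∀ x μ, U₀ x μ ∈ G)
    (hU₀per : ∀ (x : LSite (d + 1)) (μ : Fin (d + 1)), U₀ (x + P • e μ) = U₀ x)
    {η α₀ : ℝ} (hη : η ≠ 0) (hα : 0 < α₀) (hα3 : C0 (d + 1) * α₀ ≤ 1 / 3) (hα2 : 2 * α₀ ≤ c2' (d + 1) (ℓ + 1))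
    (hA : InAk (ℓ + 1) m η α₀ (fun _ => (Set.univ : Set (LSite (d + 1)))) U₀) :
    ∀ n, 1 ≤ n → n ≤ m → KnitLettersY (mem n) n η U₀ :=
  haveI : Nonempty (Fin N) := ⟨⟨0, Nat.pos_of_ne_zero (NeZero.ne N)⟩⟩
  fun n hn hnm =>
    have hper : ∀ μ : Fin (d + 1), shiftCfg ((((PV d ℓ (mem n).m (mem n).K hd hL).sitesPerDir 0 : ℕ) : ℤ) • e μ) U₀ = U₀ :=
      fun μ => funext fun x => by rw [shiftCfg_apply, hP n hn hnm, hU₀per]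
    knitLettersY_ofParKnitY (mem n) (hlev n hn hnm) hG hU₀G hper
      (parKnitY_mem_of_inAk (mem n) (hlev n hn hnm) hn hGa hU₀G hper hα hα3 hα2 (inAk_univ_of_le hnm hA)) hη

/-- the letters of the family ARE the junction's: `G′ = GpKnitY`. [cite: Balaban1985BackgroundPropagators, (3.25) p.395, bookkeeping] -/
theorem knitLettersY_familyOfInAk_G' (mem : ℕ → KIdx d ℓ hd hL b₀ b₁) {m : ℕ} {P : ℤ}
    (hP : ∀ n, 1 ≤ n → n ≤ m → (((PV d ℓ (mem n).m (mem n).K hd hL).sitesPerDir 0 : ℕ) : ℤ) = P)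
    (hlev : ∀ n, 1 ≤ n → n ≤ m → ∀ z : SiteY (mem n), levY (mem n) z = n)
    (hG : G ≤ unitaryUnits (Matrix (Fin N) (Fin N) ℂ)) (hGa : AvgClosed (d + 1) (ℓ + 1) G)
    {U₀ : LSite (d + 1) → Fin (d + 1) → (Matrix (Fin N) (Fin N) ℂ)ˣ} (hU₀G : ∀ x μ, U₀ x μ ∈ G)
    (hU₀per : ∀ (x : LSite (d + 1)) (μ : Fin (d + 1)), U₀ (x + P • e μ) = U₀ x)
    {η α₀ : ℝ} (hη : η ≠ 0) (hα : 0 < α₀) (hα3 : C0 (d + 1) * α₀ ≤ 1 / 3) (hα2 : 2 * α₀ ≤ c2' (d + 1) (ℓ + 1))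
    (hA : InAk (ℓ + 1) m η α₀ (fun _ => (Set.univ : Set (LSite (d + 1)))) U₀) {n : ℕ} (hn : 1 ≤ n) (hnm : n ≤ m) :
    (knitLettersY_familyOfInAk mem hP hlev hG hGa hU₀G hU₀per hη hα hα3 hα2 hA n hn hnm).G' = GpKnitY (mem n) η (bgY (mem n) U₀) := rfl

/-- `C′ = (Q′(η²G′)²Q′*)⁻¹` of the junction. [cite: Balaban1985RegularSpaces, (1.97) p.92, bookkeeping] -/
theorem knitLettersY_familyOfInAk_C' (mem : ℕ → KIdx d ℓ hd hL b₀ b₁) {m : ℕ} {P : ℤ}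
    (hP : ∀ n, 1 ≤ n → n ≤ m → (((PV d ℓ (mem n).m (mem n).K hd hL).sitesPerDir 0 : ℕ) : ℤ) = P)
    (hlev : ∀ n, 1 ≤ n → n ≤ m → ∀ z : SiteY (mem n), levY (mem n) z = n)
    (hG : G ≤ unitaryUnits (Matrix (Fin N) (Fin N) ℂ)) (hGa : AvgClosed (d + 1) (ℓ + 1) G)
    {U₀ : LSite (d + 1) → Fin (d + 1) → (Matrix (Fin N) (Fin N) ℂ)ˣ} (hU₀G : ∀ x μ, U₀ x μ ∈ G)
    (hU₀per : ∀ (x : LSite (d + 1)) (μ : Fin (d + 1)), U₀ (x + P • e μ) = U₀ x)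
    {η α₀ : ℝ} (hη : η ≠ 0) (hα : 0 < α₀) (hα3 : C0 (d + 1) * α₀ ≤ 1 / 3) (hα2 : 2 * α₀ ≤ c2' (d + 1) (ℓ + 1))
    (hA : InAk (ℓ + 1) m η α₀ (fun _ => (Set.univ : Set (LSite (d + 1)))) U₀) {n : ℕ} (hn : 1 ≤ n) (hnm : n ≤ m) :
    (knitLettersY_familyOfInAk mem hP hlev hG hGa hU₀G hU₀per hη hα hα3 hα2 hA n hn hnm).C'
      = XinvY (mem n) (parKnitY (mem n)) ((((η * η : ℝ)) : ℂ) • GpY (mem n) (parKnitY (mem n))) (bgY (mem n) U₀) := rfl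

/-- `H′ = G′²Q′*(Q′G′²Q′*)⁻¹` of the junction. [cite: Balaban1985RegularSpaces, (1.91) p.91, bookkeeping] -/
theorem knitLettersY_familyOfInAk_H' (mem : ℕ → KIdx d ℓ hd hL b₀ b₁) {m : ℕ} {P : ℤ}
    (hP : ∀ n, 1 ≤ n → n ≤ m → (((PV d ℓ (mem n).m (mem n).K hd hL).sitesPerDir 0 : ℕ) : ℤ) = P)
    (hlev : ∀ n, 1 ≤ n → n ≤ m → ∀ z : SiteY (mem n), levY (mem n) z = n)
    (hG : G ≤ unitaryUnits (Matrix (Fin N) (Fin N) ℂ)) (hGa : AvgClosed (d + 1) (ℓ + 1) G)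
    {U₀ : LSite (d + 1) → Fin (d + 1) → (Matrix (Fin N) (Fin N) ℂ)ˣ} (hU₀G : ∀ x μ, U₀ x μ ∈ G)
    (hU₀per : ∀ (x : LSite (d + 1)) (μ : Fin (d + 1)), U₀ (x + P • e μ) = U₀ x)
    {η α₀ : ℝ} (hη : η ≠ 0) (hα : 0 < α₀) (hα3 : C0 (d + 1) * α₀ ≤ 1 / 3) (hα2 : 2 * α₀ ≤ c2' (d + 1) (ℓ + 1))
    (hA : InAk (ℓ + 1) m η α₀ (fun _ => (Set.univ : Set (LSite (d + 1)))) U₀) {n : ℕ} (hn : 1 ≤ n) (hnm : n ≤ m) :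
    (knitLettersY_familyOfInAk mem hP hlev hG hGa hU₀G hU₀per hη hα hα3 hα2 hA n hn hnm).H'
      = GpY (mem n) (parKnitY (mem n)) (bgY (mem n) U₀) ∘ₗ GpY (mem n) (parKnitY (mem n)) (bgY (mem n) U₀)
          ∘ₗ QpsY (mem n) (parKnitY (mem n)) (bgY (mem n) U₀) ∘ₗ XinvY (mem n) (parKnitY (mem n)) (GpY (mem n) (parKnitY (mem n))) (bgY (mem n) U₀) := rfl

/-- ★★ **THE v3 LETTER BUNDLE AT ONE BACKGROUND OF THE CLASS (1.7), FROM [4]'s OBJECTS** — file A2's `lettersAtPer_ofParKnitY` with the knit-leg hypothesis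
discharged: the hypotheses are the binder's own (`G`-valued, `P`-periodic, `U₀ ∈ 𝔄_m(T_η, α₀)`) plus the member family, `G ≤ U(N)` averaging-closed, `α₀` below
[B7] Prop. 2's thresholds, `η ≠ 0`, and the displayed estimate bundle `KnitEstimates`.
[cite: Balaban1985RegularSpaces, Thm 2 p.83, (1.7) p.77, p.77 («Ω_j = T_η»), (1.91)–(1.98) pp.91–92, (1.101) p.93, (1.59) p.86; Balaban1985BackgroundPropagators, (3.19)–(3.25) pp.393–395, Thms 3.1–3.3 pp.397–399; Balaban1985Averaging, Prop. 2 p.26] -/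
def lettersAtPer_ofInAk (mem : ℕ → KIdx d ℓ hd hL b₀ b₁) {m : ℕ} {P : ℤ}
    (hP : ∀ n, 1 ≤ n → n ≤ m → (((PV d ℓ (mem n).m (mem n).K hd hL).sitesPerDir 0 : ℕ) : ℤ) = P)
    (hlev : ∀ n, 1 ≤ n → n ≤ m → ∀ z : SiteY (mem n), levY (mem n) z = n)
    (hG : G ≤ unitaryUnits (Matrix (Fin N) (Fin N) ℂ)) (hGa : AvgClosed (d + 1) (ℓ + 1) G)
    {U₀ : LSite (d + 1) → Fin (d + 1) → (Matrix (Fin N) (Fin N) ℂ)ˣ} (hU₀G : ∀ x μ, U₀ x μ ∈ G)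
    (hU₀per : ∀ (x : LSite (d + 1)) (μ : Fin (d + 1)), U₀ (x + P • e μ) = U₀ x)
    {η α₀ : ℝ} (hη : η ≠ 0) (hα : 0 < α₀) (hα3 : C0 (d + 1) * α₀ ≤ 1 / 3) (hα2 : 2 * α₀ ≤ c2' (d + 1) (ℓ + 1))
    (hA : InAk (ℓ + 1) m η α₀ (fun _ => (Set.univ : Set (LSite (d + 1)))) U₀)
    {BG BR B₀'H B₂' B₀ B₀β cB β : ℝ} {len : LSite (d + 1) → ℝ}
    (est : letI : CStarAlgebra (Matrix (Fin N) (Fin N) ℂ) := {}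
      KnitEstimates (𝔸 := Matrix (Fin N) (Fin N) ℂ) mem η U₀ (knitLettersY_familyOfInAk mem hP hlev hG hGa hU₀G hU₀per hη hα hα3 hα2 hA)
        (ℓ + 1) BG BR B₀'H B₂' B₀ B₀β cB β len α₀ P) :
    letI : CStarAlgebra (Matrix (Fin N) (Fin N) ℂ) := {}
    LettersAtPer (𝔸 := Matrix (Fin N) (Fin N) ℂ) (ℓ + 1) BG BR B₀'H B₂' B₀ B₀β cB β len η m α₀ P U₀ :=
  letI : CStarAlgebra (Matrix (Fin N) (Fin N) ℂ) := {}
  lettersAtPer_ofKnit mem η U₀ (knitLettersY_familyOfInAk mem hP hlev hG hGa hU₀G hU₀per hη hα hα3 hα2 hA) hP hlev hU₀per est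

/-- **THE FAMILY AT TRUNCATION `m ≤ k` OF A k-LEVEL DATUM** — the def-Y-side bundles the binder uses at truncation `m`, regularity `α₀ ≤ c_L` and background
`U₀` (the family `knitLettersY_familyOfInAk` with the k-level member data restricted to `n ≤ m` and Prop. 2's thresholds read off `α₀ ≤ c_L`).  This is the term the
estimate bundle `KnitEstimates` of the binder is ABOUT. [cite: Balaban1985RegularSpaces, Thm 2 p.83, (1.7) p.77, (1.91)–(1.98) pp.91–92; Balaban1985BackgroundPropagators, (3.24)–(3.25) pp.394–395] -/
def knitLettersY_familyAt (mem : ℕ → KIdx d ℓ hd hL b₀ b₁) {k : ℕ} {P : ℤ}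
    (hP : ∀ n, 1 ≤ n → n ≤ k → (((PV d ℓ (mem n).m (mem n).K hd hL).sitesPerDir 0 : ℕ) : ℤ) = P)
    (hlev : ∀ n, 1 ≤ n → n ≤ k → ∀ z : SiteY (mem n), levY (mem n) z = n)
    (hG : G ≤ unitaryUnits (Matrix (Fin N) (Fin N) ℂ)) (hGa : AvgClosed (d + 1) (ℓ + 1) G)
    {η : ℝ} (hη : η ≠ 0) {cL : ℝ} (hc3 : C0 (d + 1) * cL ≤ 1 / 3) (hc2 : 2 * cL ≤ c2' (d + 1) (ℓ + 1))
    {m : ℕ} (hm : m ≤ k) {α₀ : ℝ} (hα : 0 < α₀) (hc : α₀ ≤ cL)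
    {U₀ : LSite (d + 1) → Fin (d + 1) → (Matrix (Fin N) (Fin N) ℂ)ˣ} (hU₀G : ∀ x μ, U₀ x μ ∈ G)
    (hU₀per : ∀ (x : LSite (d + 1)) (μ : Fin (d + 1)), U₀ (x + P • e μ) = U₀ x)
    (hA : InAk (ℓ + 1) m η α₀ (fun _ => (Set.univ : Set (LSite (d + 1)))) U₀) :
    ∀ n, 1 ≤ n → n ≤ m → KnitLettersY (mem n) n η U₀ :=
  knitLettersY_familyOfInAk mem (fun n hn hnm => hP n hn (hnm.trans hm)) (fun n hn hnm => hlev n hn (hnm.trans hm)) hG hGa hU₀G hU₀per hη hα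
    (threshold3_of_le hc hc3) (threshold2_of_le hc hc2) hA

/-- ★★★ **THE BINDER `LettersAllPer` OF THE G-B8-T2S ENDPOINT, CONSTRUCTED FROM [4]'s OBJECTS AT PRINT's TRANSPORTERS.**  Data: ONE family `mem` of constant-level
members of the k-level family on the torus of side `P` (member `n` of level `n`, `1 ≤ n ≤ k`); `G ≤ U(N)` averaging-closed; `η ≠ 0`; a regularity threshold `c_L`
below [B7] Prop. 2's (`C₀c_L ≤ 1∕3`, `2c_L ≤ c₂′`); and, AT EVERY truncation `m ≤ k`, regularity `0 < α₀ ≤ c_L` and `G`-valued `P`-periodic background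
`U₀ ∈ 𝔄_m(T_η, α₀)`, the displayed estimate bundle `KnitEstimates` for the letters of `knitLettersY_familyAt` — [4]'s `η²G′(U₀)`, `(Q′(η²G′)²Q′*)⁻¹(U₀)`,
`G′²Q′*(Q′G′²Q′*)⁻¹(U₀)` at print's transporters.  Conclusion: `LettersAllPer (ℓ+1) BG BR B₀'H B₂' B₀ B₀β cB β len c_L η k P G` — the displayed hypothesis of
`B8Thm2TorusAtOfLettersPerB9.thm2TorusAt_specialUnitary_of_lettersPerB9` ∕ `B8Thm2SetupTorusOfLettersPerB9.thm2SetupSUAt_of_lettersPerB9`, now CONCRETE: its letters ARE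
[4]'s operators and what remains displayed are the six printed inequalities for them ((1.92), (1.101), (1.98), (1.59)), background by background.
HONEST SCOPE: no estimate proved; member family ∕ `AvgClosed` ∕ thresholds displayed; count-neutral; `stub_PV3A` NOT discharged; the Yang–Mills mass gap is NOT proved.
[cite: Balaban1985RegularSpaces, Thm 2 p.83, Thm 4 p.88, (1.7) p.77, p.77 («Ω_j = T_η»), (1.33) p.82, (1.91)–(1.98) pp.91–92, (1.101) p.93, (1.59) p.86; Balaban1985BackgroundPropagators, (3.19)–(3.25) pp.393–395, Thms 3.1–3.3 pp.397–399, Thm 3.11 p.416; Balaban1985Averaging, Prop. 2 p.26] -/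
def lettersAllPer_ofParKnitY (mem : ℕ → KIdx d ℓ hd hL b₀ b₁) {k : ℕ} {P : ℤ}
    (hP : ∀ n, 1 ≤ n → n ≤ k → (((PV d ℓ (mem n).m (mem n).K hd hL).sitesPerDir 0 : ℕ) : ℤ) = P)
    (hlev : ∀ n, 1 ≤ n → n ≤ k → ∀ z : SiteY (mem n), levY (mem n) z = n)
    (hG : G ≤ unitaryUnits (Matrix (Fin N) (Fin N) ℂ)) (hGa : AvgClosed (d + 1) (ℓ + 1) G)
    {η : ℝ} (hη : η ≠ 0) {cL : ℝ} (hc3 : C0 (d + 1) * cL ≤ 1 / 3) (hc2 : 2 * cL ≤ c2' (d + 1) (ℓ + 1))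
    {BG BR B₀'H B₂' B₀ B₀β cB β : ℝ} {len : LSite (d + 1) → ℝ}
    (est : letI : CStarAlgebra (Matrix (Fin N) (Fin N) ℂ) := {}
      ∀ (m : ℕ) (hm : m ≤ k) (α₀ : ℝ) (hα : 0 < α₀) (hc : α₀ ≤ cL) (U₀ : LSite (d + 1) → Fin (d + 1) → (Matrix (Fin N) (Fin N) ℂ)ˣ)
        (hU₀G : ∀ x κ, U₀ x κ ∈ G) (hU₀per : ∀ (x : LSite (d + 1)) (μ : Fin (d + 1)), U₀ (x + P • e μ) = U₀ x)
        (hA : InAk (ℓ + 1) m η α₀ (fun _ => (Set.univ : Set (LSite (d + 1)))) U₀),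
        KnitEstimates (𝔸 := Matrix (Fin N) (Fin N) ℂ) mem η U₀ (knitLettersY_familyAt mem hP hlev hG hGa hη hc3 hc2 hm hα hc hU₀G hU₀per hA)
          (ℓ + 1) BG BR B₀'H B₂' B₀ B₀β cB β len α₀ P) :
    letI : CStarAlgebra (Matrix (Fin N) (Fin N) ℂ) := {}
    LettersAllPer (𝔸 := Matrix (Fin N) (Fin N) ℂ) (ℓ + 1) BG BR B₀'H B₂' B₀ B₀β cB β len cL η k P G :=
  letI : CStarAlgebra (Matrix (Fin N) (Fin N) ℂ) := {}
  fun m hm α₀ hα hc U₀ hU₀G hU₀per hA =>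
    lettersAtPer_ofKnit mem η U₀ (knitLettersY_familyAt mem hP hlev hG hGa hη hc3 hc2 hm hα hc hU₀G hU₀per hA)
      (fun n hn hnm => hP n hn (hnm.trans hm)) (fun n hn hnm => hlev n hn (hnm.trans hm)) hU₀per (est m hm α₀ hα hc U₀ hU₀G hU₀per hA)

/-- ★ **THE `τ`-LAWS BINDER** (`LettersAllPerTau τ`) for the binder above, from the def-Y-side `τ`-laws at every background (displayed: `KnitLettersYTau τ`, the statement
that [4]'s letters map `τ`-free data to `τ`-free values — print p. 76, `G = SU(N)`, `τ = tr`).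
[cite: Balaban1985RegularSpaces, p.76, (1.91)–(1.98) pp.91–92] -/
theorem lettersAllPerTau_ofParKnitY (τ : Matrix (Fin N) (Fin N) ℂ →L[ℂ] ℂ) (mem : ℕ → KIdx d ℓ hd hL b₀ b₁) {k : ℕ} {P : ℤ}
    (hP : ∀ n, 1 ≤ n → n ≤ k → (((PV d ℓ (mem n).m (mem n).K hd hL).sitesPerDir 0 : ℕ) : ℤ) = P)
    (hlev : ∀ n, 1 ≤ n → n ≤ k → ∀ z : SiteY (mem n), levY (mem n) z = n)
    (hG : G ≤ unitaryUnits (Matrix (Fin N) (Fin N) ℂ)) (hGa : AvgClosed (d + 1) (ℓ + 1) G)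
    {η : ℝ} (hη : η ≠ 0) {cL : ℝ} (hc3 : C0 (d + 1) * cL ≤ 1 / 3) (hc2 : 2 * cL ≤ c2' (d + 1) (ℓ + 1))
    {BG BR B₀'H B₂' B₀ B₀β cB β : ℝ} {len : LSite (d + 1) → ℝ}
    (est : letI : CStarAlgebra (Matrix (Fin N) (Fin N) ℂ) := {}
      ∀ (m : ℕ) (hm : m ≤ k) (α₀ : ℝ) (hα : 0 < α₀) (hc : α₀ ≤ cL) (U₀ : LSite (d + 1) → Fin (d + 1) → (Matrix (Fin N) (Fin N) ℂ)ˣ)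
        (hU₀G : ∀ x κ, U₀ x κ ∈ G) (hU₀per : ∀ (x : LSite (d + 1)) (μ : Fin (d + 1)), U₀ (x + P • e μ) = U₀ x)
        (hA : InAk (ℓ + 1) m η α₀ (fun _ => (Set.univ : Set (LSite (d + 1)))) U₀),
        KnitEstimates (𝔸 := Matrix (Fin N) (Fin N) ℂ) mem η U₀ (knitLettersY_familyAt mem hP hlev hG hGa hη hc3 hc2 hm hα hc hU₀G hU₀per hA)
          (ℓ + 1) BG BR B₀'H B₂' B₀ B₀β cB β len α₀ P)
    (hτ : ∀ (m : ℕ) (hm : m ≤ k) (α₀ : ℝ) (hα : 0 < α₀) (hc : α₀ ≤ cL) (U₀ : LSite (d + 1) → Fin (d + 1) → (Matrix (Fin N) (Fin N) ℂ)ˣ)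
        (hU₀G : ∀ x κ, U₀ x κ ∈ G) (hU₀per : ∀ (x : LSite (d + 1)) (μ : Fin (d + 1)), U₀ (x + P • e μ) = U₀ x)
        (hA : InAk (ℓ + 1) m η α₀ (fun _ => (Set.univ : Set (LSite (d + 1)))) U₀),
        ∀ n (hn : 1 ≤ n) (hnm : n ≤ m), KnitLettersYTau τ (knitLettersY_familyAt mem hP hlev hG hGa hη hc3 hc2 hm hα hc hU₀G hU₀per hA n hn hnm)) :
    letI : CStarAlgebra (Matrix (Fin N) (Fin N) ℂ) := {}
    LettersAllPerTau (𝔸 := Matrix (Fin N) (Fin N) ℂ) τ (lettersAllPer_ofParKnitY mem hP hlev hG hGa hη hc3 hc2 est) := by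
  letI : CStarAlgebra (Matrix (Fin N) (Fin N) ℂ) := {}
  intro m hm α₀ hα hc U₀ hU₀G hU₀per hA
  exact lettersPerTau_ofKnit mem η U₀ (knitLettersY_familyAt mem hP hlev hG hGa hη hc3 hc2 hm hα hc hU₀G hU₀per hA) τ
    (fun n hn hnm => hP n hn (hnm.trans hm)) (fun n hn hnm => hlev n hn (hnm.trans hm)) hU₀per (est m hm α₀ hα hc U₀ hU₀G hU₀per hA)
    (hτ m hm α₀ hα hc U₀ hU₀G hU₀per hA)

end Binder

/-! ## §3 At `G = SU(N)`, `N ≤ 25`: the binder with the group hypotheses discharged, and [B8] Thm 2 on `T_η` FROM [4]'s objects modulo the printed estimates -/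

section SpecialUnitary

open scoped Matrix Matrix.Norms.L2Operator
open B7Prop2SpecialUnitary (specialUnitaryUnits specialUnitaryUnits_le_unitaryUnits)
open B7AvgClosedSpecialUnitarySharp (avgClosed_specialUnitary_of_le)
open B8SpecialUnitaryTrace (trCLM)
open B8Thm2TorusAt (Thm2TorusAt)
open B8Thm2TorusAtOfLettersPerB9 (thm2TorusAt_specialUnitary_of_lettersPerB9)

variable {N : ℕ} [NeZero N]

/-- ★★★ **THE BINDER AT `G = SU(N)`, `N ≤ 25`** — `SU(N) ≤ U(N)` (`specialUnitaryUnits_le_unitaryUnits`) and `SU(N)` averaging-closed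
(`B7AvgClosedSpecialUnitarySharp.avgClosed_specialUnitary_of_le`): the hypothesis `LettersAllPer (ℓ+1) … c_L η k P (specialUnitaryUnits (Fin N))` of the G-B8-T2S endpoint from
ONE member family, `η ≠ 0`, `c_L` below [B7] Prop. 2's thresholds, and the displayed estimate bundle per background.  No estimate proved; the Yang–Mills mass gap is NOT proved.
[cite: Balaban1985RegularSpaces, Thm 2 p.83, p.76 («G = SU(N)»), (1.7) p.77, (1.91)–(1.98) pp.91–92; Balaban1985Averaging, Prop. 2 p.26, (42)–(43) pp.23–24; Balaban1985BackgroundPropagators, (3.24)–(3.25) pp.394–395] -/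
def lettersAllPer_specialUnitary_ofParKnitY (hN : N ≤ 25) (mem : ℕ → KIdx d ℓ hd hL b₀ b₁) {k : ℕ} {P : ℤ}
    (hP : ∀ n, 1 ≤ n → n ≤ k → (((PV d ℓ (mem n).m (mem n).K hd hL).sitesPerDir 0 : ℕ) : ℤ) = P)
    (hlev : ∀ n, 1 ≤ n → n ≤ k → ∀ z : SiteY (mem n), levY (mem n) z = n)
    {η : ℝ} (hη : η ≠ 0) {cL : ℝ} (hc3 : C0 (d + 1) * cL ≤ 1 / 3) (hc2 : 2 * cL ≤ c2' (d + 1) (ℓ + 1))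
    {BG BR B₀'H B₂' B₀ B₀β cB β : ℝ} {len : LSite (d + 1) → ℝ}
    (est : letI : CStarAlgebra (Matrix (Fin N) (Fin N) ℂ) := {}
      ∀ (m : ℕ) (hm : m ≤ k) (α₀ : ℝ) (hα : 0 < α₀) (hc : α₀ ≤ cL) (U₀ : LSite (d + 1) → Fin (d + 1) → (Matrix (Fin N) (Fin N) ℂ)ˣ)
        (hU₀G : ∀ x κ, U₀ x κ ∈ specialUnitaryUnits (Fin N)) (hU₀per : ∀ (x : LSite (d + 1)) (μ : Fin (d + 1)), U₀ (x + P • e μ) = U₀ x)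
        (hA : InAk (ℓ + 1) m η α₀ (fun _ => (Set.univ : Set (LSite (d + 1)))) U₀),
        KnitEstimates (𝔸 := Matrix (Fin N) (Fin N) ℂ) mem η U₀
          (knitLettersY_familyAt mem hP hlev specialUnitaryUnits_le_unitaryUnits (avgClosed_specialUnitary_of_le hN (d + 1) (ℓ + 1)) hη hc3 hc2 hm hα hc
            hU₀G hU₀per hA)
          (ℓ + 1) BG BR B₀'H B₂' B₀ B₀β cB β len α₀ P) :
    letI : CStarAlgebra (Matrix (Fin N) (Fin N) ℂ) := {}
    LettersAllPer (𝔸 := Matrix (Fin N) (Fin N) ℂ) (ℓ + 1) BG BR B₀'H B₂' B₀ B₀β cB β len cL η k P (specialUnitaryUnits (Fin N)) :=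
  lettersAllPer_ofParKnitY mem hP hlev specialUnitaryUnits_le_unitaryUnits (avgClosed_specialUnitary_of_le hN (d + 1) (ℓ + 1)) hη hc3 hc2 est

/-- ★★★★ **[B8] THM 2 ON `T_η` FOR `SU(N)` (`N ≤ 25`, `d + 1 ≥ 2`, `L = ℓ + 1`), ITS LANDAU-GAUGE LETTERS BEING [4]'s OPERATORS AT PRINT's TRANSPORTERS — MODULO THE
PRINTED ESTIMATES.**  The G-B8-T2S endpoint `B8Thm2TorusAtOfLettersPerB9.thm2TorusAt_specialUnitary_of_lettersPerB9` COMPOSED with the binders of this file: uniform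
constants `B₂, c₁ > 0` such that for every `k ≥ 1`, `η > 0`, `P ∈ LᵏZ`, GIVEN (i) a family of constant-level members of the k-level family on the torus of side `P`,
(ii) at every truncation `m ≤ k`, regularity `α₀ ≤ c_L` and `SU(N)`-valued `P`-periodic `U₀ ∈ 𝔄_m(T_η, α₀)` the six printed inequalities (1.92), (1.101), (1.98), (1.59)
for [4]'s `η²G′(U₀)`, `(Q′(η²G′)²Q′*)⁻¹(U₀)`, `G′²Q′*(Q′G′²Q′*)⁻¹(U₀)` (`KnitEstimates`), (iii) their trace laws (`KnitLettersYTau tr`), the interface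
`Thm2TorusAt (ℓ+1) k P η 0 B₁ B₂ c₁ len SU(N) ⊤` of [B8] Thm 2 holds — with the endpoint's numeric windows on `B₀, B₀′, B₀′ᴴ, B₂′, B_G, B_R, c_{B9}, c_L, B₁` and
`c_L` below [B7] Prop. 2's thresholds.  HONEST SCOPE: (i)–(iii) are displayed hypotheses, none inhabited here; count-neutral; `stub_PV3A` NOT discharged; nothing
continuum ∕ ℝ⁴ ∕ OS ∕ mass-gap ∕ Clay — the Yang–Mills mass gap is NOT proved.
[cite: Balaban1985RegularSpaces, Thm 2 p.83, Thm 4 p.88, (1.7) p.77, p.76, p.77 («Ω_j = T_η»), (1.33) p.82, (1.91)–(1.98) pp.91–92, (1.101) p.93, (1.59) p.86; Balaban1985BackgroundPropagators, (3.19)–(3.25) pp.393–395, Thms 3.1–3.3 pp.397–399, Thm 3.11 p.416; Balaban1985Averaging, Prop. 2 p.26] -/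
theorem thm2TorusAt_specialUnitary_ofParKnitY (hN : N ≤ 25) (hd2 : 2 ≤ d + 1)
    {B₀ B₀' B₀'H B₂' BG BR B₀β cB9 β cL B₁ : ℝ} {len : LSite (d + 1) → ℝ}
    (hB₀ : 0 < B₀) (hB₀' : 0 < B₀') (hB : 2 ≤ 5 * ((d + 1 : ℕ) : ℝ) * ((ℓ + 1 : ℕ) : ℝ) * B₀) (hB₀'H : 0 < B₀'H) (hB₂' : 0 ≤ B₂') (hBG : 0 ≤ BG)
    (hBR : 0 ≤ BR) (hcB9 : 0 < cB9) (hcL : 0 < cL) (hfree : 3 * (2 * ((d + 1 : ℕ) : ℝ) * (((ℓ + 1 : ℕ) : ℝ)) ^ 2) * BG * (BR + 2) ≤ B₀')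
    (hB₁ : 5 * ((d + 1 : ℕ) : ℝ) * ((ℓ + 1 : ℕ) : ℝ) * B₀ * (1 + 11 * (((d + 1 : ℕ) : ℝ)) ^ 2) < B₁)
    (hc3 : C0 (d + 1) * cL ≤ 1 / 3) (hc2 : 2 * cL ≤ c2' (d + 1) (ℓ + 1)) :
    letI : CStarAlgebra (Matrix (Fin N) (Fin N) ℂ) := {}
    ∃ B₂ c₁ : ℝ, 0 < B₂ ∧ 0 < c₁ ∧ ∀ (k : ℕ) (P : ℤ) (η : ℝ), 1 ≤ k → ∀ hη : 0 < η, (∃ M : ℤ, P = ((ℓ + 1 : ℕ) : ℤ) ^ k * M) →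
      ∀ (mem : ℕ → KIdx d ℓ hd hL b₀ b₁)
        (hP : ∀ n, 1 ≤ n → n ≤ k → (((PV d ℓ (mem n).m (mem n).K hd hL).sitesPerDir 0 : ℕ) : ℤ) = P)
        (hlev : ∀ n, 1 ≤ n → n ≤ k → ∀ z : SiteY (mem n), levY (mem n) z = n),
        (∀ (m : ℕ) (hm : m ≤ k) (α₀ : ℝ) (hα : 0 < α₀) (hc : α₀ ≤ cL) (U₀ : LSite (d + 1) → Fin (d + 1) → (Matrix (Fin N) (Fin N) ℂ)ˣ)
            (hU₀G : ∀ x κ, U₀ x κ ∈ specialUnitaryUnits (Fin N)) (hU₀per : ∀ (x : LSite (d + 1)) (μ : Fin (d + 1)), U₀ (x + P • e μ) = U₀ x)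
            (hA : InAk (ℓ + 1) m η α₀ (fun _ => (Set.univ : Set (LSite (d + 1)))) U₀),
            KnitEstimates (𝔸 := Matrix (Fin N) (Fin N) ℂ) mem η U₀
              (knitLettersY_familyAt mem hP hlev specialUnitaryUnits_le_unitaryUnits (avgClosed_specialUnitary_of_le hN (d + 1) (ℓ + 1)) hη.ne' hc3 hc2 hm
                hα hc hU₀G hU₀per hA)
              (ℓ + 1) BG BR B₀'H B₂' B₀ B₀β cB9 β len α₀ P) →
        (∀ (m : ℕ) (hm : m ≤ k) (α₀ : ℝ) (hα : 0 < α₀) (hc : α₀ ≤ cL) (U₀ : LSite (d + 1) → Fin (d + 1) → (Matrix (Fin N) (Fin N) ℂ)ˣ)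
            (hU₀G : ∀ x κ, U₀ x κ ∈ specialUnitaryUnits (Fin N)) (hU₀per : ∀ (x : LSite (d + 1)) (μ : Fin (d + 1)), U₀ (x + P • e μ) = U₀ x)
            (hA : InAk (ℓ + 1) m η α₀ (fun _ => (Set.univ : Set (LSite (d + 1)))) U₀),
            ∀ n (hn : 1 ≤ n) (hnm : n ≤ m), KnitLettersYTau (trCLM (Fin N))
              (knitLettersY_familyAt mem hP hlev specialUnitaryUnits_le_unitaryUnits (avgClosed_specialUnitary_of_le hN (d + 1) (ℓ + 1)) hη.ne' hc3 hc2 hm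
                hα hc hU₀G hU₀per hA n hn hnm)) →
      Thm2TorusAt (ℓ + 1) k P η 0 B₁ B₂ c₁ len (specialUnitaryUnits (Fin N)) (fun _ => True) := by
  letI : CStarAlgebra (Matrix (Fin N) (Fin N) ℂ) := {}
  obtain ⟨B₂, c₁, hB₂, hc₁, H⟩ :=
    thm2TorusAt_specialUnitary_of_lettersPerB9 (len := len) hN hd2 (L := ℓ + 1) hL.2 hB₀ hB₀' hB hB₀'H hB₂' hBG hBR hcB9 hcL hfree hB₁
  refine ⟨B₂, c₁, hB₂, hc₁, fun k P η hk hη hPk mem hP hlev est hτ => ?_⟩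
  exact H k P η hk hη hPk (lettersAllPer_specialUnitary_ofParKnitY hN mem hP hlev hη.ne' hc3 hc2 est)
    (lettersAllPerTau_ofParKnitY (trCLM (Fin N)) mem hP hlev specialUnitaryUnits_le_unitaryUnits (avgClosed_specialUnitary_of_le hN (d + 1) (ℓ + 1))
      hη.ne' hc3 hc2 est hτ)

end SpecialUnitary

end Literature.MathematicalPhysics.QuantumFieldTheory.Balaban1983to89.B8Thm2TorusLettersAllPerOfKnit

end
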